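import Literature.NumberTheory.Rogawski1990.CartanIndex
import Literature.NumberTheory.Rogawski1990.AdelicCartanClass
import Literature.NumberTheory.GaloisRepresentations.HasseNormEtaleInvolutionMatrix
import HarnessLib

/-!
# The obstruction `cartanObs : 𝒞′_𝐀(γ₀) → (ℤ∕2)^{r′}` of a regular stable class of `U(H)` as DATA: the adelic Cartan algebra map `Ψ`,
# the adelic Cartan class as an element of `𝔸_{L⁺} ⊗_{L⁺} L[γ₀]`, and the factorwise «principal × norm» indicator
# (Rogawski 1990, §3.3 (3.3.1) p. 22, §3.5 Prop. 3.5.2 p. 29; Kottwitz 1986 §9)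

Topic `NumberTheory/Rogawski1990`; namespace `Literature.NumberTheory.Rogawski1990`; DEFINITIONS with bodies + theorems; **no named fact,
no `sorry`, no instance, no notation**.  Cell `pub/hodgecm-mathlib`, ENGINE T1 (crux H413 = `stmt-HodgeConjecture-24833`), row G6 «pre-stabilisation
for the `U(3)` tori», sub-row R6d of `BLUEPRINT-R6dR7-CartanObsHasse.F0P5a-p03g4` (0a35b92f): the OBJECT `obs` that ★ P5
`cartanObsHasse_of_steps` (`CartanObsHasseOfSteps`), ★ (KS-2b) `PreStabilisationCountSigns` and ★ (R𝓡) `PreStabilisationKappaCount` quantify over.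
HC_CM is proved only modulo the printed citations until rung 0 closes.

THE PRINT.  [Rogawski1990, §3.3 p. 22]: for `γ′ ∈ 𝒞′_𝐀(γ₀)` (adelically stably conjugate to the rational regular `γ₀`), `γ′ = g γ₀ g⁻¹` adelically,
«`obs(γ′) ∈ A(T)` … the image of the class `{τ(g) g⁻¹}`»; [§3.5 Prop. 3.5.2 (c) p. 29]: `A(T) = {ε ∈ ⊕_{j τ-stable} ℤ∕2 : Σ ε_j = 0}`
over the τ-STABLE field factors `K_j` of the Cartan algebra `L[γ₀] ≅ ∏ K_j` (`τ` the `H`-adjoint), the `j`-th coordinate being the quadratic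
norm-residue symbol of `K_j ∕ K_j^τ` at the `j`-component of the Cartan class; [Kottwitz1986, §9]: the same through `H¹(𝐀, T)`.

WHAT IS TYPED (three definitions, each with its unfolding lemma; everything else is ★ by instantiation).
* §1 **`adelicCartanGlue B : 𝔸_F ⊗_F B →ₐ[F] M_N(𝔸_L)`**, `r ⊗ b ↦ con(r) · (b ⊗ 1)`, for ANY `L`-subalgebra `B ≤ M_N(L)` and any
  `F ⊆ L` (binders `[Algebra F 𝔸_L] [IsScalarTower F L 𝔸_L]`; at `F := L⁺` both are GLOBAL instances of the tree) — the proof-internal `Ψ`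
  of ★ (M2) `HasseNormEtaleInvolutionMatrix` made a NAMED map: `adelicCartanGlue_tmul` is the `hΨ` of ★ (G1)–(G3), so
  `adelicCartanGlue_injective` (G1), `mem_range_adelicCartanGlue_of_commute` (G2), `adelicCartanGlue_map_eq_hermStar` (G3) are one-liners.
* §2 (CM letters: `L` CM, `σ = cmConjRingHom L`, `H` hermitian invertible, `γ₀ ∈ U(H)(L⁺)` regular, `B := L[γ₀] = Algebra.adjoin L {γ₀}`,
  `τ := cartanInvolution` ★ R6d-α, `x_g := (H ⊗ 1)⁻¹ (H ⊗ 1)_g` the adelic Cartan class of ★ R6d-β, `Ψ := adelicCartanGlue B` at `F := L⁺`):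
  **`exists_unit_adelicCartanGlue_eq`** — for every adelic conjugator `g` of a matching adèle `p` (`g (γ₀ ⊗ 1) g⁻¹ = p`), `x_g = Ψ X` for a
  UNIT `X` of `𝔸_{L⁺} ⊗_{L⁺} B` with `(1 ⊗ τ) X = X` (★ `commute_adelicCartan` + (G2) + (G1); ★ `hermStar_adelicCartan` + (G3));
  **`MatchingAdeleG₂.adelicConjugator`** (a CHOSEN conjugator, ★ R6b `exists_gl_conj_eq_adele`) and **`MatchingAdeleG₂.adelicCartanRepr p : (𝔸_{L⁺} ⊗ B)ˣ`**
  (the chosen `X` for the chosen `g`) with `adelicCartanGlue_adelicCartanRepr`, `map_cartanInvolution_adelicCartanRepr`.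
* §3 **`MatchingAdeleG₂.cartanObsFun p : cartanIndex … → ZMod 2`**, `𝔪 ↦ 0` iff the projection of `X = adelicCartanRepr p` to
  `𝔸_{L⁺} ⊗ (B ∕ 𝔪)` is «PRINCIPAL τ-fixed × NORM» — LITERALLY the `hloc` clause of ★ (D3) `exists_fixed_unit_tmul_mul_mul_map_eq`
  (`∃ k u u′, k ∉ 𝔪 ∧ τ k − k ∈ 𝔪 ∧ (1 ⊗ π_𝔪)(u u′) = 1 ∧ (1 ⊗ π_𝔪) X = (1 ⊗ π_𝔪)((1 ⊗ k) u (1 ⊗ τ) u)`), `else 1`; `cartanObsFun_eq_zero_iff`,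
  `cartanObsFun_eq_zero_or_eq_one`.  That this IS the quadratic Artin indicator `[W_𝔪]_{K₀,𝔪, d}` of the descended idèle (★ A-p14
  `quadraticArtinIndicator_eq_zero_iff_exists_repr`, ★ `QuadraticArtinIndicatorFixedField`), that `∑_𝔪 = 0` (so `obs ∈ A(T)` = ★ `cartanObsSubgroup`),
  and the GLOBAL reading `cartanObsFun p = 0 ↔ x_g = t⋆ (y ⊗ 1) t` (= P5's `hglob`) are the kernel-lane sequels `CartanObstruction{Global,Indicator}`.

WHY THIS SHAPE.  The definition mentions no residue-field ∕ fixed-field number-field instances (those live in the sequels' STATEMENTS, presented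
abstractly as in ★ R3′∕R3″), so the DEF is three honest bodies over ★ carriers; conjugator-independence is a THEOREM of the sequel (★
`exists_commute_adelicCartan_eq_of_conj_eq`: `x_{g′} = s⋆ x_g s`), not a quotient in the definition.

## References
* [Rogawski1990] J. D. Rogawski, *Automorphic Representations of Unitary Groups in Three Variables*, Ann. of Math. Stud. 123 (1990), §3.3 (3.3.1),
  Prop. 3.3.1 p. 22; §3.5 Prop. 3.5.2 p. 29; §5.4 p. 72.
* [Kottwitz1986] R. E. Kottwitz, *Stable trace formula: elliptic singular terms*, Math. Ann. 275 (1986), §7, §9.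
* [CasselsFrohlichANT1967] Cassels–Fröhlich (eds.), *Algebraic Number Theory* (1967), Ch. II §19 (19.1); Ch. VII §7.1.
-/

set_option autoImplicit false

noncomputable section

open NumberField IsDedekindDomain Polynomial
open scoped TensorProduct Matrix MatrixGroups

namespace Literature.NumberTheory.Rogawski1990

open Literature.NumberTheory.Automorphic Literature.NumberTheory.GaloisRepresentations Literature.LinearAlgebra.Matrix
open Literature.AlgebraicGeometry.ShimuraVarieties (unitaryGroup mem_unitaryGroup_iff)

/-! ## §1 The adelic Cartan algebra map `Ψ : 𝔸_F ⊗_F B → M_N(𝔸_L)`, `r ⊗ b ↦ con(r) · (b ⊗ 1)` — as a named definition -/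

section Glue

open scoped NumberField.AdeleRing
open Literature.NumberTheory.AdelicBaseChange

variable {F L : Type} [Field F] [NumberField F] [Field L] [NumberField L] [Algebra F L]
  [Algebra F (AdeleRing (𝓞 L) L)] [IsScalarTower F L (AdeleRing (𝓞 L) L)] {N : ℕ} (B : Subalgebra L (Matrix (Fin N) (Fin N) L))

/-- **`adelicCartanGlue B : 𝔸_F ⊗_F B →ₐ[F] M_N(𝔸_L)`, `r ⊗ b ↦ con(r) · (b ⊗ 1)`** — the `F`-algebra map from the adelic points of an
`L`-subalgebra `B ≤ M_N(L)` (for us: the Cartan algebra `L[γ₀]`) into the adelic matrices; `con : 𝔸_F → 𝔸_L` is the tree's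
`AdeleRing.baseChange` (Cassels–Fröhlich (19.1)) and the two factors commute because `con(r)` is a scalar.  This is the `Ψ` built inside the
proof of ★ `exists_commute_mul_hermAdjoint_eq_of_adelic`, now named. [cite: CasselsFrohlichANT1967, Ch. II §19 (19.1)] [cite: Rogawski1990, §3.5 p. 29] -/
def adelicCartanGlue : AdeleRing (𝓞 F) F ⊗[F] ↥B →ₐ[F] Matrix (Fin N) (Fin N) (AdeleRing (𝓞 L) L) :=
  Algebra.TensorProduct.lift
    { toRingHom := (algebraMap (AdeleRing (𝓞 L) L) (Matrix (Fin N) (Fin N) (AdeleRing (𝓞 L) L))).comp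
        (Literature.NumberTheory.Automorphic.AdeleRing.baseChange F L)
      commutes' := fun q => by
        change algebraMap (AdeleRing (𝓞 L) L) (Matrix (Fin N) (Fin N) (AdeleRing (𝓞 L) L))
            (Literature.NumberTheory.Automorphic.AdeleRing.baseChange F L (algebraMap F (AdeleRing (𝓞 F) F) q)) =
          algebraMap F (Matrix (Fin N) (Fin N) (AdeleRing (𝓞 L) L)) q
        rw [Literature.NumberTheory.Automorphic.AdeleRing.baseChange_algebraMap, ← IsScalarTower.algebraMap_apply F L (AdeleRing (𝓞 L) L) q,
          ← IsScalarTower.algebraMap_apply F (AdeleRing (𝓞 L) L) (Matrix (Fin N) (Fin N) (AdeleRing (𝓞 L) L)) q] }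
    (((Algebra.ofId L (AdeleRing (𝓞 L) L)).mapMatrix.comp B.val).restrictScalars F)
    (fun _ _ => Algebra.commutes _ _)

/-- **`Ψ (r ⊗ b) = con(r) · (b ⊗ 1)`** — the hypothesis `hΨ` under which ★ (G1)–(G3) of `HasseNormEtaleInvolutionMatrix` are stated.
[cite: CasselsFrohlichANT1967, Ch. II §19 (19.1)] -/
theorem adelicCartanGlue_tmul (r : AdeleRing (𝓞 F) F) (b : ↥B) :
    adelicCartanGlue B (r ⊗ₜ b) =
      NumberField.AdeleRing.baseChange F L r • (b : Matrix (Fin N) (Fin N) L).map (algebraMap L (AdeleRing (𝓞 L) L)) := by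
  rw [adelicCartanGlue, Algebra.TensorProduct.lift_tmul, adeleRing_baseChange_apply_eq]
  change algebraMap (AdeleRing (𝓞 L) L) (Matrix (Fin N) (Fin N) (AdeleRing (𝓞 L) L))
      (Literature.NumberTheory.Automorphic.AdeleRing.baseChange F L r) * (b : Matrix (Fin N) (Fin N) L).map (algebraMap L (AdeleRing (𝓞 L) L)) = _
  rw [← Algebra.smul_def]

/-- `Ψ (1 ⊗ b) = b ⊗ 1`. [cite: CasselsFrohlichANT1967, Ch. II §19 (19.1)] -/
theorem adelicCartanGlue_one_tmul (b : ↥B) :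
    adelicCartanGlue B ((1 : AdeleRing (𝓞 F) F) ⊗ₜ b) = (b : Matrix (Fin N) (Fin N) L).map (algebraMap L (AdeleRing (𝓞 L) L)) := by
  rw [adelicCartanGlue_tmul, map_one, one_smul]

/-- **(G1) `Ψ` is injective** (★ `injective_of_apply_tmul`). [cite: CasselsFrohlichANT1967, Ch. II §19 (19.1)] -/
theorem adelicCartanGlue_injective : Function.Injective (adelicCartanGlue (F := F) B) :=
  injective_of_apply_tmul B (adelicCartanGlue B) (adelicCartanGlue_tmul B)

/-- **(G2) the commutant of `γ ⊗ 1` lies in the range of `Ψ`** for `γ ∈ B` regular semisimple (★ `mem_range_of_commute`). [cite: Rogawski1990, §3.5 p. 29] -/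
theorem mem_range_adelicCartanGlue_of_commute {γ : Matrix (Fin N) (Fin N) L} (hγB : γ ∈ B) (hreg : γ.charpoly.Separable)
    {c : Matrix (Fin N) (Fin N) (AdeleRing (𝓞 L) L)} (hc : Commute (γ.map (algebraMap L (AdeleRing (𝓞 L) L))) c) :
    c ∈ Set.range (adelicCartanGlue (F := F) B) :=
  mem_range_of_commute B (adelicCartanGlue B) (adelicCartanGlue_tmul B) hγB hreg hc

/-- **(G3) `Ψ ((1 ⊗ τ) z) = (Ψ z)⋆`** for `τ` acting on `B` by the `H`-adjoint `b ↦ H⁻¹ ᵗ(σb) H` and `⋆` the adjoint over `(𝔸_L, σ ⊗ 1)`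
(★ `apply_map_eq_hermAdjoint`; `hermStar` is ★ R2's name for the adjoint). [cite: CasselsFrohlichANT1967, Ch. VII §7.1] [cite: Rogawski1990, §3.5 p. 29] -/
theorem adelicCartanGlue_map_eq_hermStar (σ : L ≃ₐ[F] L) (σr : L →+* L) (hσr : ∀ x, σr x = σ x)
    (σA : AdeleRing (𝓞 L) L →+* AdeleRing (𝓞 L) L) (hσA : ∀ z, σA z = σ • z) {H : Matrix (Fin N) (Fin N) L} (hHdet : IsUnit H.det)
    (τ : ↥B ≃ₐ[F] ↥B) (hτ : ∀ b : ↥B, ((τ b : ↥B) : Matrix (Fin N) (Fin N) L) = H⁻¹ * ((b : Matrix (Fin N) (Fin N) L).map σr)ᵀ * H)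
    (z : AdeleRing (𝓞 F) F ⊗[F] ↥B) :
    adelicCartanGlue B (Algebra.TensorProduct.map (AlgHom.id (AdeleRing (𝓞 F) F) (AdeleRing (𝓞 F) F)) (τ : ↥B →ₐ[F] ↥B) z) =
      hermStar σA (H.map (algebraMap L (AdeleRing (𝓞 L) L))) (adelicCartanGlue B z) :=
  apply_map_eq_hermAdjoint B (adelicCartanGlue B) (adelicCartanGlue_tmul B) σ σr hσr σA hσA hHdet τ hτ z

end Glue

/-! ## §2 The adelic Cartan class of a matching adèle as a `τ`-fixed unit of `𝔸_{L⁺} ⊗_{L⁺} L[γ₀]` -/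

section Repr

variable {L : Type} [Field L] [NumberField L] [IsCMField L] {H : Matrix (Fin 3) (Fin 3) L}

/-- **The Cartan algebra `L[γ₀] ≤ M₃(L)`** of `γ₀ ∈ U(H)(L⁺)` (Mathlib `Algebra.adjoin L {γ₀}`, the carrier of ★ R6d-α `cartanInvolution` ∕ `cartanIndex`),
abbreviated. [cite: Rogawski1990, §3.4 p. 27] -/
abbrev cartanSubalgebra (γ₀ : (UnitaryGroup.cmDatum L 3 H).Rational) : Subalgebra L (Matrix (Fin 3) (Fin 3) L) :=
  Algebra.adjoin L ({(((γ₀ : unitaryGroup (cmConjRingHom L) H).val : GL (Fin 3) L) : Matrix (Fin 3) (Fin 3) L)} : Set (Matrix (Fin 3) (Fin 3) L))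

/-- **The adelic Cartan algebra `𝔸_{L⁺} ⊗_{L⁺} L[γ₀]`** (abbreviation; `≅ Z_{M₃(𝔸_L)}(γ₀ ⊗ 1)` through `adelicCartanGlue`, ★ (G1)(G2)).
[cite: Rogawski1990, §3.5 p. 29] [cite: CasselsFrohlichANT1967, Ch. II §19 (19.1)] -/
abbrev adelicCartanAlgebra (γ₀ : (UnitaryGroup.cmDatum L 3 H).Rational) : Type :=
  AdeleRing (𝓞 ↥(maximalRealSubfield L)) ↥(maximalRealSubfield L) ⊗[↥(maximalRealSubfield L)] ↥(cartanSubalgebra γ₀)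

variable {γ₀ : (UnitaryGroup.cmDatum L 3 H).Rational}

variable (γ₀) in
/-- `γ₀` is `H`-unitary: `ᵗ(σγ₀) H γ₀ = H` (the `hγ` of ★ `cartanInvolution`). [cite: Rogawski1990, §3.4 p. 27] -/
theorem transpose_map_mul_mul_eq_of_rational :
    ((((γ₀ : unitaryGroup (cmConjRingHom L) H).val : GL (Fin 3) L) : Matrix (Fin 3) (Fin 3) L).map (cmConjRingHom L))ᵀ * H *
      (((γ₀ : unitaryGroup (cmConjRingHom L) H).val : GL (Fin 3) L) : Matrix (Fin 3) (Fin 3) L) = H :=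
  (γ₀ : unitaryGroup (cmConjRingHom L) H).2

/-- **The involution `τ = ⋆|_{L[γ₀]}` in CM letters** — ★ R6d-α `cartanInvolution` at `σ := cmConjRingHom L` (`hσF := cmConjRingHom_algebraMap`,
`hσσ := IsCMField.complexConj_apply_apply`, `hγ :=` unitarity of `γ₀`), abbreviated. [cite: Rogawski1990, §3.5 Prop. 3.5.2 p. 29] -/
abbrev cartanInvolutionCM (hH : (H.map (cmConjRingHom L))ᵀ = H) (hHd : IsUnit H.det)
    (hreg : IsRegularElt ((γ₀ : unitaryGroup (cmConjRingHom L) H).val : GL (Fin 3) L)) :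
    ↥(cartanSubalgebra γ₀) ≃ₐ[↥(maximalRealSubfield L)] ↥(cartanSubalgebra γ₀) :=
  cartanInvolution (cmConjRingHom L) (cmConjRingHom_algebraMap L) (IsCMField.complexConj_apply_apply L) hHd hH hreg
    (transpose_map_mul_mul_eq_of_rational γ₀)

/-- **The index set `ι` of the obstruction in CM letters** — ★ R6d-α `cartanIndex` (the τ-stable maximal ideals of `L[γ₀]`) at `σ := cmConjRingHom L`,
abbreviated; `r′ = Nat.card (cartanIndexCM …)`. [cite: Rogawski1990, §3.5 Prop. 3.5.2 p. 29; §3.6 p. 31] -/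
abbrev cartanIndexCM (hH : (H.map (cmConjRingHom L))ᵀ = H) (hHd : IsUnit H.det)
    (hreg : IsRegularElt ((γ₀ : unitaryGroup (cmConjRingHom L) H).val : GL (Fin 3) L)) : Type :=
  cartanIndex (cmConjRingHom L) (cmConjRingHom_algebraMap L) (IsCMField.complexConj_apply_apply L) hHd hH hreg
    (transpose_map_mul_mul_eq_of_rational γ₀)

/-- **`x_g = Ψ X` for a `τ`-FIXED UNIT `X` of `𝔸_{L⁺} ⊗_{L⁺} L[γ₀]`**, for every adelic conjugator `g` of a matching adèle `p` over the regular `γ₀`: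
`x_g` commutes with `γ₀ ⊗ 1` (★ `commute_adelicCartan`), so does `x_g⁻¹`, both lie in `range Ψ` ((G2)) and `Ψ` is injective ((G1)); `x_g⋆ = x_g`
(★ `hermStar_adelicCartan`) reads `(1 ⊗ τ) X = X` through (G3). [cite: Rogawski1990, §3.3 (3.3.1) p. 22; §3.5 Prop. 3.5.2 p. 29] [cite: Kottwitz1986, §9] -/
theorem exists_unit_adelicCartanGlue_eq (hH : (H.map (cmConjRingHom L))ᵀ = H) (hHd : IsUnit H.det)
    (hreg : IsRegularElt ((γ₀ : unitaryGroup (cmConjRingHom L) H).val : GL (Fin 3) L)) (p : MatchingAdeleG₂ L H H γ₀)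
    {g : GL (Fin 3) (AdeleRing (𝓞 L) L)}
    (hg : g * (((UnitaryGroup.cmDatum L 3 H).toAdelic γ₀).val : GL (Fin 3) (AdeleRing (𝓞 L) L)) * g⁻¹ = (p.adele.val : GL (Fin 3) (AdeleRing (𝓞 L) L))) :
    ∃ X : (adelicCartanAlgebra γ₀)ˣ,
      adelicCartanGlue (F := ↥(maximalRealSubfield L)) (cartanSubalgebra γ₀) (X : adelicCartanAlgebra γ₀) =
          (H.map (algebraMap L (AdeleRing (𝓞 L) L)))⁻¹ * twistGram (adeleConj L) (H.map (algebraMap L (AdeleRing (𝓞 L) L))) (g : Matrix (Fin 3) (Fin 3) (AdeleRing (𝓞 L) L)) ∧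
        Algebra.TensorProduct.map (AlgHom.id (AdeleRing (𝓞 ↥(maximalRealSubfield L)) ↥(maximalRealSubfield L)) (AdeleRing (𝓞 ↥(maximalRealSubfield L)) ↥(maximalRealSubfield L)))
            (cartanInvolutionCM hH hHd hreg : ↥(cartanSubalgebra γ₀) →ₐ[↥(maximalRealSubfield L)] ↥(cartanSubalgebra γ₀)) (X : adelicCartanAlgebra γ₀) = X := by
  classical
  -- letters
  set γM : Matrix (Fin 3) (Fin 3) L := (((γ₀ : unitaryGroup (cmConjRingHom L) H).val : GL (Fin 3) L) : Matrix (Fin 3) (Fin 3) L) with hγM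
  set alg := algebraMap L (AdeleRing (𝓞 L) L) with halg
  set HA : Matrix (Fin 3) (Fin 3) (AdeleRing (𝓞 L) L) := H.map alg with hHA
  set xg : Matrix (Fin 3) (Fin 3) (AdeleRing (𝓞 L) L) := HA⁻¹ * twistGram (adeleConj L) HA (g : Matrix (Fin 3) (Fin 3) (AdeleRing (𝓞 L) L)) with hxg
  have hregM : γM.charpoly.Separable := hreg
  have hγB : γM ∈ cartanSubalgebra γ₀ := Algebra.self_mem_adjoin_singleton L γM
  have hγA : ((((UnitaryGroup.cmDatum L 3 H).toAdelic γ₀).val : GL (Fin 3) (AdeleRing (𝓞 L) L)) : Matrix (Fin 3) (Fin 3) (AdeleRing (𝓞 L) L)) = γM.map alg := rfl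
  -- `x_g` commutes with `γ ⊗ 1` and is a unit
  have hcomm : Commute (γM.map alg) xg := by rw [← hγA]; exact (commute_adelicCartan hHd p hg).symm
  have hxgdet : IsUnit xg.det := by
    rw [hxg, det_adelicCartan hHd]
    exact ((Matrix.isUnits_det_units g).map (adeleConj L)).mul (Matrix.isUnits_det_units g)
  have hcomm' : Commute (γM.map alg) xg⁻¹ := by
    have h1 : xg⁻¹ * γM.map alg = xg⁻¹ * γM.map alg * (xg * xg⁻¹) := by rw [Matrix.mul_nonsing_inv xg hxgdet, Matrix.mul_one]
    change γM.map alg * xg⁻¹ = xg⁻¹ * γM.map alg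
    symm
    calc xg⁻¹ * γM.map alg = xg⁻¹ * (γM.map alg * xg) * xg⁻¹ := by rw [h1]; simp only [Matrix.mul_assoc]
      _ = xg⁻¹ * (xg * γM.map alg) * xg⁻¹ := by rw [hcomm.eq]
      _ = γM.map alg * xg⁻¹ := by rw [← Matrix.mul_assoc, Matrix.nonsing_inv_mul xg hxgdet, Matrix.one_mul]
  -- preimages under `Ψ`
  obtain ⟨X₀, hX₀⟩ := mem_range_adelicCartanGlue_of_commute (F := ↥(maximalRealSubfield L)) (cartanSubalgebra γ₀) hγB hregM hcomm
  obtain ⟨X₁, hX₁⟩ := mem_range_adelicCartanGlue_of_commute (F := ↥(maximalRealSubfield L)) (cartanSubalgebra γ₀) hγB hregM hcomm'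
  have hinj := adelicCartanGlue_injective (F := ↥(maximalRealSubfield L)) (cartanSubalgebra γ₀)
  have h01 : X₀ * X₁ = 1 := hinj (by rw [map_mul, hX₀, hX₁, Matrix.mul_nonsing_inv xg hxgdet, map_one])
  have h10 : X₁ * X₀ = 1 := hinj (by rw [map_mul, hX₀, hX₁, Matrix.nonsing_inv_mul xg hxgdet, map_one])
  refine ⟨⟨X₀, X₁, h01, h10⟩, hX₀, hinj ?_⟩
  -- `Ψ ((1 ⊗ τ) X₀) = x_g⋆ = x_g = Ψ X₀`
  refine (adelicCartanGlue_map_eq_hermStar (cartanSubalgebra γ₀) (IsCMField.complexConj L) (cmConjRingHom L) (fun _ => rfl) (adeleConj L)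
      (adeleConj_apply L) hHd (cartanInvolutionCM hH hHd hreg)
      (coe_cartanInvolution (cmConjRingHom L) (cmConjRingHom_algebraMap L) (IsCMField.complexConj_apply_apply L) hHd hH hreg
        (transpose_map_mul_mul_eq_of_rational γ₀)) X₀).trans ?_
  rw [hX₀]
  exact hermStar_adelicCartan hH hHd _

/-- **A CHOSEN adelic conjugator** `g(p) ∈ GL₃(𝔸_L)` of a matching adèle `p` over a regular `γ₀`: `g (γ₀ ⊗ 1) g⁻¹ = p` (★ R6b
`MatchingAdeleG₂.exists_gl_conj_eq_adele`).  Any two conjugators give norm-equivalent Cartan classes (★ `exists_commute_adelicCartan_eq_of_conj_eq`),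
so nothing downstream depends on the choice. [cite: Rogawski1990, §3.3 (3.3.1) p. 22] [cite: Kottwitz1986, §9] -/
def MatchingAdeleG₂.adelicConjugator (hreg : IsRegularElt ((γ₀ : unitaryGroup (cmConjRingHom L) H).val : GL (Fin 3) L))
    (p : MatchingAdeleG₂ L H H γ₀) : GL (Fin 3) (AdeleRing (𝓞 L) L) :=
  (p.exists_gl_conj_eq_adele hreg).choose

/-- `g(p) (γ₀ ⊗ 1) g(p)⁻¹ = p`. [cite: Rogawski1990, §3.3 (3.3.1) p. 22] -/
theorem MatchingAdeleG₂.adelicConjugator_conj (hreg : IsRegularElt ((γ₀ : unitaryGroup (cmConjRingHom L) H).val : GL (Fin 3) L))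
    (p : MatchingAdeleG₂ L H H γ₀) :
    p.adelicConjugator hreg * (((UnitaryGroup.cmDatum L 3 H).toAdelic γ₀).val : GL (Fin 3) (AdeleRing (𝓞 L) L)) * (p.adelicConjugator hreg)⁻¹ =
      (p.adele.val : GL (Fin 3) (AdeleRing (𝓞 L) L)) :=
  (p.exists_gl_conj_eq_adele hreg).choose_spec

/-- **`adelicCartanRepr p ∈ (𝔸_{L⁺} ⊗_{L⁺} L[γ₀])ˣ`** — the adelic Cartan class `x_{g(p)} = (H ⊗ 1)⁻¹ (H ⊗ 1)_{g(p)}` of the chosen conjugator,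
pulled back through `Ψ` to a `τ`-fixed unit of the adelic Cartan algebra (`exists_unit_adelicCartanGlue_eq`).  This is the `X` that ★ R3′∕R3″ read
factor by factor. [cite: Rogawski1990, §3.3 (3.3.1) p. 22; §3.5 Prop. 3.5.2 p. 29] [cite: Kottwitz1986, §9] -/
def MatchingAdeleG₂.adelicCartanRepr (hH : (H.map (cmConjRingHom L))ᵀ = H) (hHd : IsUnit H.det)
    (hreg : IsRegularElt ((γ₀ : unitaryGroup (cmConjRingHom L) H).val : GL (Fin 3) L)) (p : MatchingAdeleG₂ L H H γ₀) :
    (adelicCartanAlgebra γ₀)ˣ :=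
  (exists_unit_adelicCartanGlue_eq hH hHd hreg p (p.adelicConjugator_conj hreg)).choose

/-- **`Ψ (adelicCartanRepr p) = x_{g(p)}`**. [cite: Rogawski1990, §3.3 (3.3.1) p. 22] -/
theorem MatchingAdeleG₂.adelicCartanGlue_adelicCartanRepr (hH : (H.map (cmConjRingHom L))ᵀ = H) (hHd : IsUnit H.det)
    (hreg : IsRegularElt ((γ₀ : unitaryGroup (cmConjRingHom L) H).val : GL (Fin 3) L)) (p : MatchingAdeleG₂ L H H γ₀) :
    adelicCartanGlue (F := ↥(maximalRealSubfield L)) (cartanSubalgebra γ₀) ((p.adelicCartanRepr hH hHd hreg : (adelicCartanAlgebra γ₀)ˣ) : adelicCartanAlgebra γ₀) =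
      (H.map (algebraMap L (AdeleRing (𝓞 L) L)))⁻¹ * twistGram (adeleConj L) (H.map (algebraMap L (AdeleRing (𝓞 L) L)))
        ((p.adelicConjugator hreg : GL (Fin 3) (AdeleRing (𝓞 L) L)) : Matrix (Fin 3) (Fin 3) (AdeleRing (𝓞 L) L)) :=
  (exists_unit_adelicCartanGlue_eq hH hHd hreg p (p.adelicConjugator_conj hreg)).choose_spec.1

/-- **`(1 ⊗ τ) (adelicCartanRepr p) = adelicCartanRepr p`** — the class is `τ`-fixed (the `hX` of ★ (D3)). [cite: Rogawski1990, §3.5 Prop. 3.5.2 p. 29] -/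
theorem MatchingAdeleG₂.map_cartanInvolutionCM_adelicCartanRepr (hH : (H.map (cmConjRingHom L))ᵀ = H) (hHd : IsUnit H.det)
    (hreg : IsRegularElt ((γ₀ : unitaryGroup (cmConjRingHom L) H).val : GL (Fin 3) L)) (p : MatchingAdeleG₂ L H H γ₀) :
    Algebra.TensorProduct.map (AlgHom.id (AdeleRing (𝓞 ↥(maximalRealSubfield L)) ↥(maximalRealSubfield L)) (AdeleRing (𝓞 ↥(maximalRealSubfield L)) ↥(maximalRealSubfield L)))
        (cartanInvolutionCM hH hHd hreg : ↥(cartanSubalgebra γ₀) →ₐ[↥(maximalRealSubfield L)] ↥(cartanSubalgebra γ₀))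
        ((p.adelicCartanRepr hH hHd hreg : (adelicCartanAlgebra γ₀)ˣ) : adelicCartanAlgebra γ₀) =
      p.adelicCartanRepr hH hHd hreg :=
  (exists_unit_adelicCartanGlue_eq hH hHd hreg p (p.adelicConjugator_conj hreg)).choose_spec.2

end Repr

/-! ## §3 The obstruction, factor by factor: «is the `𝔪`-component principal × norm?» -/

section Obs

variable {L : Type} [Field L] [NumberField L] [IsCMField L] {H : Matrix (Fin 3) (Fin 3) L} {γ₀ : (UnitaryGroup.cmDatum L 3 H).Rational}

/-- **«PRINCIPAL `τ`-FIXED × NORM at the factor `𝔪`»** — the `hloc` clause of ★ (D3) `exists_fixed_unit_tmul_mul_mul_map_eq` for an element `X` of the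
adelic Cartan algebra at a maximal ideal `𝔪` of `L[γ₀]`: `∃ k u u′, k ∉ 𝔪 ∧ τ k − k ∈ 𝔪 ∧ (1 ⊗ π_𝔪)(u u′) = 1 ∧ (1 ⊗ π_𝔪) X = (1 ⊗ π_𝔪)((1 ⊗ k) u (1 ⊗ τ) u)`,
`π_𝔪 : L[γ₀] → L[γ₀] ∕ 𝔪`.  For `𝔪` τ-stable this says: the `𝔪`-component of `X` is a principal idèle of the fixed field times an idelic norm from
`K_𝔪 = L[γ₀] ∕ 𝔪` — the quadratic norm-residue symbol of `K_𝔪 ∕ K_𝔪^τ` vanishes [Prop. 3.5.2 (c)]. [cite: Rogawski1990, §3.5 Prop. 3.5.2 p. 29] [cite: Kottwitz1986, §9] -/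
def IsPrincipalNormAt (hH : (H.map (cmConjRingHom L))ᵀ = H) (hHd : IsUnit H.det)
    (hreg : IsRegularElt ((γ₀ : unitaryGroup (cmConjRingHom L) H).val : GL (Fin 3) L)) (X : adelicCartanAlgebra γ₀)
    (𝔪 : MaximalSpectrum ↥(cartanSubalgebra γ₀)) : Prop :=
  ∃ (k : ↥(cartanSubalgebra γ₀)) (u u' : adelicCartanAlgebra γ₀),
    k ∉ 𝔪.asIdeal ∧ cartanInvolutionCM hH hHd hreg k - k ∈ 𝔪.asIdeal ∧
    Algebra.TensorProduct.map (AlgHom.id (AdeleRing (𝓞 ↥(maximalRealSubfield L)) ↥(maximalRealSubfield L)) (AdeleRing (𝓞 ↥(maximalRealSubfield L)) ↥(maximalRealSubfield L)))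
        (Ideal.Quotient.mkₐ (↥(maximalRealSubfield L)) 𝔪.asIdeal) (u * u') = 1 ∧
    Algebra.TensorProduct.map (AlgHom.id (AdeleRing (𝓞 ↥(maximalRealSubfield L)) ↥(maximalRealSubfield L)) (AdeleRing (𝓞 ↥(maximalRealSubfield L)) ↥(maximalRealSubfield L)))
        (Ideal.Quotient.mkₐ (↥(maximalRealSubfield L)) 𝔪.asIdeal) X =
      Algebra.TensorProduct.map (AlgHom.id (AdeleRing (𝓞 ↥(maximalRealSubfield L)) ↥(maximalRealSubfield L)) (AdeleRing (𝓞 ↥(maximalRealSubfield L)) ↥(maximalRealSubfield L)))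
        (Ideal.Quotient.mkₐ (↥(maximalRealSubfield L)) 𝔪.asIdeal)
        ((1 : AdeleRing (𝓞 ↥(maximalRealSubfield L)) ↥(maximalRealSubfield L)) ⊗ₜ k * u *
          Algebra.TensorProduct.map (AlgHom.id (AdeleRing (𝓞 ↥(maximalRealSubfield L)) ↥(maximalRealSubfield L)) (AdeleRing (𝓞 ↥(maximalRealSubfield L)) ↥(maximalRealSubfield L)))
            (cartanInvolutionCM hH hHd hreg : ↥(cartanSubalgebra γ₀) →ₐ[↥(maximalRealSubfield L)] ↥(cartanSubalgebra γ₀)) u)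

/-- **`cartanObsFun p : ι → ℤ∕2`** — the obstruction of the adelic class `p ∈ 𝒞′_𝐀(γ₀)` read on the τ-STABLE simple factors `𝔪 ∈ ι` of the Cartan
algebra `L[γ₀]`: the `𝔪`-coordinate is `0` iff the adelic Cartan class `X = adelicCartanRepr p` is «principal `τ`-fixed × norm» at `𝔪` (`IsPrincipalNormAt`),
i.e. iff the quadratic norm-residue symbol of `K_𝔪 ∕ K_𝔪^τ` at the `𝔪`-component vanishes [Prop. 3.5.2 (c)], and `1` otherwise.  (That `∑_𝔪 = 0`, so
that the vector lies in ★ `cartanObsSubgroup ι = A(T)`, is the sequel's theorem.) [cite: Rogawski1990, §3.3 (3.3.1) p. 22; §3.5 Prop. 3.5.2 p. 29] [cite: Kottwitz1986, §9] -/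
def MatchingAdeleG₂.cartanObsFun (hH : (H.map (cmConjRingHom L))ᵀ = H) (hHd : IsUnit H.det)
    (hreg : IsRegularElt ((γ₀ : unitaryGroup (cmConjRingHom L) H).val : GL (Fin 3) L)) (p : MatchingAdeleG₂ L H H γ₀)
    (𝔪 : cartanIndexCM hH hHd hreg) : ZMod 2 := by
  classical
  exact if IsPrincipalNormAt hH hHd hreg ((p.adelicCartanRepr hH hHd hreg : (adelicCartanAlgebra γ₀)ˣ) : adelicCartanAlgebra γ₀) 𝔪.1 then 0 else 1

/-- `cartanObsFun p 𝔪 = 0 ↔` the class is principal × norm at `𝔪`. [cite: Rogawski1990, §3.5 Prop. 3.5.2 p. 29] -/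
theorem MatchingAdeleG₂.cartanObsFun_eq_zero_iff (hH : (H.map (cmConjRingHom L))ᵀ = H) (hHd : IsUnit H.det)
    (hreg : IsRegularElt ((γ₀ : unitaryGroup (cmConjRingHom L) H).val : GL (Fin 3) L)) (p : MatchingAdeleG₂ L H H γ₀) (𝔪 : cartanIndexCM hH hHd hreg) :
    p.cartanObsFun hH hHd hreg 𝔪 = 0 ↔
      IsPrincipalNormAt hH hHd hreg ((p.adelicCartanRepr hH hHd hreg : (adelicCartanAlgebra γ₀)ˣ) : adelicCartanAlgebra γ₀) 𝔪.1 := by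
  classical
  unfold MatchingAdeleG₂.cartanObsFun
  by_cases h : IsPrincipalNormAt hH hHd hreg ((p.adelicCartanRepr hH hHd hreg : (adelicCartanAlgebra γ₀)ˣ) : adelicCartanAlgebra γ₀) 𝔪.1
  · rw [if_pos h]; exact ⟨fun _ => h, fun _ => rfl⟩
  · rw [if_neg h]; exact ⟨fun h10 => absurd h10 one_ne_zero, fun h' => absurd h' h⟩

/-- `cartanObsFun p 𝔪 ∈ {0, 1}`. [cite: Rogawski1990, §3.5 Prop. 3.5.2 p. 29] -/
theorem MatchingAdeleG₂.cartanObsFun_eq_zero_or_eq_one (hH : (H.map (cmConjRingHom L))ᵀ = H) (hHd : IsUnit H.det)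
    (hreg : IsRegularElt ((γ₀ : unitaryGroup (cmConjRingHom L) H).val : GL (Fin 3) L)) (p : MatchingAdeleG₂ L H H γ₀) (𝔪 : cartanIndexCM hH hHd hreg) :
    p.cartanObsFun hH hHd hreg 𝔪 = 0 ∨ p.cartanObsFun hH hHd hreg 𝔪 = 1 := by
  classical
  unfold MatchingAdeleG₂.cartanObsFun
  by_cases h : IsPrincipalNormAt hH hHd hreg ((p.adelicCartanRepr hH hHd hreg : (adelicCartanAlgebra γ₀)ˣ) : adelicCartanAlgebra γ₀) 𝔪.1
  · exact Or.inl (if_pos h)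
  · exact Or.inr (if_neg h)

/-- `cartanObsFun p 𝔪 = 1 ↔` the class is NOT principal × norm at `𝔪`. [cite: Rogawski1990, §3.5 Prop. 3.5.2 p. 29] -/
theorem MatchingAdeleG₂.cartanObsFun_eq_one_iff (hH : (H.map (cmConjRingHom L))ᵀ = H) (hHd : IsUnit H.det)
    (hreg : IsRegularElt ((γ₀ : unitaryGroup (cmConjRingHom L) H).val : GL (Fin 3) L)) (p : MatchingAdeleG₂ L H H γ₀) (𝔪 : cartanIndexCM hH hHd hreg) :
    p.cartanObsFun hH hHd hreg 𝔪 = 1 ↔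
      ¬ IsPrincipalNormAt hH hHd hreg ((p.adelicCartanRepr hH hHd hreg : (adelicCartanAlgebra γ₀)ˣ) : adelicCartanAlgebra γ₀) 𝔪.1 := by
  rw [← p.cartanObsFun_eq_zero_iff hH hHd hreg 𝔪]
  rcases p.cartanObsFun_eq_zero_or_eq_one hH hHd hreg 𝔪 with h | h
  · rw [h]; exact ⟨fun h01 => absurd h01 zero_ne_one, fun hn => absurd rfl hn⟩
  · rw [h]; exact ⟨fun _ => one_ne_zero, fun _ => rfl⟩

/-- **`cartanObsFun p = 0` (as a vector) iff the class is principal × norm at EVERY τ-stable factor** — the shape in which ★ P5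
`cartanObsHasse_of_steps` reads `obs p = 0` for `obs := cartanObsFun`, `A := ι → ℤ∕2`. [cite: Rogawski1990, §3.3 Prop. 3.3.1 p. 22; §3.5 Prop. 3.5.2 p. 29] -/
theorem MatchingAdeleG₂.cartanObsFun_eq_zero_iff_forall (hH : (H.map (cmConjRingHom L))ᵀ = H) (hHd : IsUnit H.det)
    (hreg : IsRegularElt ((γ₀ : unitaryGroup (cmConjRingHom L) H).val : GL (Fin 3) L)) (p : MatchingAdeleG₂ L H H γ₀) :
    p.cartanObsFun hH hHd hreg = 0 ↔
      ∀ 𝔪 : cartanIndexCM hH hHd hreg,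
        IsPrincipalNormAt hH hHd hreg ((p.adelicCartanRepr hH hHd hreg : (adelicCartanAlgebra γ₀)ˣ) : adelicCartanAlgebra γ₀) 𝔪.1 := by
  rw [funext_iff]
  exact forall_congr' fun 𝔪 => p.cartanObsFun_eq_zero_iff hH hHd hreg 𝔪

end Obs

end Literature.NumberTheory.Rogawski1990

end
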